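import Mathlib.Topology.Instances.ZMod
import Mathlib.GroupTheory.FreeGroup.NielsenSchreier
import Literature.IUT.HodgeTheaters.StableCurveTemperedDataOfSpecialFibreSec2OneCallFrame
import Literature.AnabelianGeometry.SemiGraphs.ProSigmaCompletionExtend
import Literature.AnabelianGeometry.SemiGraphs.ProSigmaCompletionTransport
import HarnessLib

/-!
# [IUTchI] Prop. 2.4 / Cor. 2.5 at the genuine 𝔛-datum: the §2 one-call's law `hTF`
# ("`Δ̂_X` is strongly torsion-free", [Config] Rmk. 1.2.2) DERIVED from the free-profinite origin of `Δ̂_X`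

S. Mochizuki, *Inter-universal Teichmüller theory I*, kurims manuscript (May 2020), §2, proof of
Proposition 2.4 (i), p. 50 l. 27: "since [as is well-known — cf., e.g., [Config], Remark 1.2.2] `Δ̂_X` is
*strongly torsion-free*" [cite: Mochizuki2012, Prop 2.4(i) p.50]; Corollary 2.5 p. 51
[cite: Mochizuki2012, Cor 2.5 p.51] (D-0012 claim key, status disputed — the content of this file is plain
profinite group theory plus bookkeeping and takes no side).

PROOF-ONLY sequel (abc-iut cell, seat abc-iut-L5-t11 gen 14, row «SEC2-HTF-FROM-FREEPRO») of
`StableCurveTemperedDataOfSpecialFibreSec2OneCallFrame.lean` (p493190).  There the §2 one-call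
`prop24_cor25_ofPiData_byName_noRF_frame` carries SIX law binders `hTF · hNN_i · hab · hadm · hI_j^frame ·
hA3ar_j`; the first, `hTF`, is the PRINTED form of "[Config] Rmk 1.2.2" on `Δ̂_X = X.DeltaHat`: for every open
`H ≤ Δ̂_X`, detection of `h ∈ H` by a continuous finite abelian character persists to `h ^ n` (`n ≠ 0`).

This file PROVES `hTF` from the ORIGIN fact about `Δ̂_X` that the [IUTchI] Cor. 2.3 (iii)/(iv) closers of
record already display (GAP-LEDGER G-w4d052-g6-2, binder shape `{Γ} [IsFreeGroup Γ] {ι : Γ →* Δ̂_X}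
(hι : IsProSigmaCompletion {q | q.Prime} ι)` — "`Δ̂_X` is the profinite completion of a free group", the
geometric fundamental group of an AFFINE hyperbolic curve; nonabelianness is not needed here), for free `Γ`
of ANY rank:

* § A (generic, namespace `FreeProSigmaStrongTorsionFree`): `sigmaCharDetects_univ_pow_of_isProSigmaCompletion`
  — if `P` is profinite and `ι : Γ → P` exhibits `P` as a pro-`Σ` completion of a FREE group `Γ` with `Σ`
  containing every prime, then every open subgroup `U ≤ P` is strongly torsion-free in character form.
  Proof ("cd `≤ 1`"): given a continuous `χ : U → A`, `A` finite abelian, `χ u ≠ 1`, put `m := n · |A|` and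
  let `α : (ℤ/m)^A ↠ A` be the tautological envelope (`e_a ↦ a`); `α` kills every `n`-torsion element of
  `(ℤ/m)^A` (its coordinates lie in `|A| · ℤ/m`).  Lift `χ ∘ ι` generator-wise through `α` on the free group
  `ι⁻¹(U)` (Nielsen–Schreier, Mathlib) and extend CONTINUOUSLY to `θ : U → (ℤ/m)^A` by abc-iut-L3's
  `IsProSigmaCompletion.exists_continuous_extend` ([SemiAnbd] Ex. 2.10); `α ∘ θ = χ` by density
  (`continuous_ext_on`).  Then `θ(u)^n = 1` would force `χ u = α (θ u) = 1`; so `θ` detects `u ^ n`.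
* § B (the genuine 𝔛-datum): `StableCurveTemperedData.OfSpecialFibre.hTF_of_isProSigmaCompletion` — the
  one-call's binder `hTF` VERBATIM on `X.DeltaHat`, from `hι`; and `…_deltaHat` — the same with `ι` landing in
  the datum's `(ofSpecialFibre …).DeltaHat` (`= X.DeltaHat`, `ofSpecialFibre_deltaHat`), i.e. literally the
  (x) binder of the Cor. 2.3 (iii)/(iv) closers.
* § C: the one-call sequel `prop24_cor25_ofPiData_byName_noRF_frame_of_freePro` = p493190's frame one-call
  with `hTF` REPLACED by `hι`: law count 6 → 5 (`hNN_i · hab · hadm · hI_j^frame · hA3ar_j`) plus ONE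
  FACT-INSTANCE-shaped origin binder (x), shared with the Cor. 2.3 (iii)/(iv) closers of record.

HONEST TAGS.  (x) is an ORIGIN fact about `Δ̂_X` (affine `X`), consumed BY NAME, not proved here; for a
PROPER curve the analogous input is the surface-group completion (abc-iut-w5-d119's
`ProfiniteCompletionSurfaceAbelianTorsionFree.lean`, finite rank, Mathlib's completion), not covered by § A.
Joint non-vacuity of the (x)-form binder set is NOT claimed here (the `hTF`-form NV files p479269 / p493381
stand).  CONDITIONAL as labelled; typed ≠ inhabited ≠ discharged; nothing here asserts that abc is proved or
refuted, and nothing here bears on [IUTchIII] Cor. 3.12.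
-/

noncomputable section

namespace Literature.IUT.HodgeTheaters

open _root_.Topology
open scoped Pointwise
open Literature.AnabelianGeometry.Anabelioids (IsSigmaInteger)
open Literature.AnabelianGeometry.SemiGraphs Literature.AnabelianGeometry.SemiGraphs.ProfiniteSemiGraph
open Literature.AnabelianGeometry.SemiGraphs.SemiGraphOfAnabelioids (IsProSigmaCompletion)

/-! ### A. Generic: open subgroups of the pro-`Σ` completion of a free group are strongly torsion-free -/

namespace FreeProSigmaStrongTorsionFree

universe v w

/-- A homomorphism with open kernel into a discrete group is continuous. [folklore] -/
private theorem continuous_of_isOpen_ker {H : Type*} [Group H] [TopologicalSpace H] [ContinuousMul H]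
    {A : Type*} [Group A] [TopologicalSpace A] [DiscreteTopology A] (χ : H →* A)
    (hχ : IsOpen ((χ.ker : Subgroup H) : Set H)) : Continuous χ := by
  refine continuous_def.2 fun s _ => isOpen_iff_mem_nhds.2 fun x hx => ?_
  have ho : IsOpen ((fun y : H => x⁻¹ * y) ⁻¹' ((χ.ker : Subgroup H) : Set H)) :=
    hχ.preimage (continuous_const.mul continuous_id)
  refine Filter.mem_of_superset (ho.mem_nhds (by simp)) fun y hy => ?_
  have hy' : χ (x⁻¹ * y) = 1 := hy
  rw [map_mul, map_inv, inv_mul_eq_one] at hy'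
  show χ y ∈ s
  rw [← hy']
  exact hx

variable {Sigma : Set ℕ} {Γ : Type w} [Group Γ] [IsFreeGroup Γ]
  {P : Type v} [Group P] [TopologicalSpace P] [IsTopologicalGroup P] [CompactSpace P]
  [TotallyDisconnectedSpace P] {ι : Γ →* P}

/-- **Open subgroups of the pro-`Σ` completion of a FREE group are strongly torsion-free** (`Σ ⊇` all
primes; character form of "[Config] Rmk 1.2.2" for the profinite completion of a free group of ANY rank):
for `U ≤ P` open, `u ∈ U`, `n ≠ 0`, if some continuous character of `U` to a finite abelian group is
nontrivial on `u`, then some such character is nontrivial on `u ^ n`.  Proof: cd `≤ 1` lifting of the given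
character through the envelope `(ℤ/n|A|)^A ↠ A` (abc-iut-L3's `IsProSigmaCompletion.exists_continuous_extend`
on the free group `ι⁻¹(U)`), whose `n`-torsion dies in `A`. [cite: Mochizuki2012, Prop 2.4(i) p.50] -/
theorem sigmaCharDetects_univ_pow_of_isProSigmaCompletion (hι : IsProSigmaCompletion Sigma ι)
    (hSig : ∀ q : ℕ, q.Prime → q ∈ Sigma) (U : Subgroup P) (hU : IsOpen (U : Set P)) (u : U) (n : ℕ)
    (hn : n ≠ 0) (hdet : SigmaCharDetects Set.univ U u) : SigmaCharDetects Set.univ U (u ^ n) := by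
  classical
  obtain ⟨A, instA, instF, χ, hχker, -, hχu⟩ := hdet
  haveI : Fintype A := Fintype.ofFinite A
  letI : TopologicalSpace A := ⊥
  haveI : DiscreteTopology A := ⟨rfl⟩
  have hcard : 0 < Nat.card A := Nat.card_pos
  -- the modulus `m := n · |A|`
  haveI hm : NeZero (n * Nat.card A) := ⟨mul_ne_zero hn hcard.ne'⟩
  -- the envelope `ψ : (ℤ/m)^A → A`, `e_a ↦ a` (additively written target)
  have hkill : ∀ a : A,
      (zmultiplesHom (Additive A) (Additive.ofMul a)) ((n * Nat.card A : ℕ) : ℤ) = 0 := by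
    intro a
    rw [zmultiplesHom_apply, natCast_zsmul, mul_nsmul]
    exact card_nsmul_eq_zero'
  let φ : A → (ZMod (n * Nat.card A) →+ Additive A) := fun a =>
    ZMod.lift (n * Nat.card A) ⟨zmultiplesHom (Additive A) (Additive.ofMul a), hkill a⟩
  have hφ_nat : ∀ (a : A) (k : ℕ), φ a (k : ZMod (n * Nat.card A)) = k • Additive.ofMul a := by
    intro a k
    have := ZMod.lift_coe (n * Nat.card A) ⟨zmultiplesHom (Additive A) (Additive.ofMul a), hkill a⟩ (k : ℤ)
    rw [Int.cast_natCast] at this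
    rw [this]
    change (zmultiplesHom (Additive A) (Additive.ofMul a)) (k : ℤ) = _
    rw [zmultiplesHom_apply, natCast_zsmul]
  let ψ : (A → ZMod (n * Nat.card A)) →+ Additive A :=
    ∑ a : A, (φ a).comp (Pi.evalAddMonoidHom (fun _ : A => ZMod (n * Nat.card A)) a)
  have hψ_apply : ∀ f : A → ZMod (n * Nat.card A), ψ f = ∑ a, φ a (f a) := fun f => by
    simp only [ψ, AddMonoidHom.finsetSum_apply, AddMonoidHom.comp_apply, Pi.evalAddMonoidHom_apply]
  -- (1) the envelope kills the `n`-torsion of `(ℤ/m)^A`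
  have hkey : ∀ f : A → ZMod (n * Nat.card A), n • f = 0 → ψ f = 0 := by
    intro f hf
    rw [hψ_apply]
    refine Finset.sum_eq_zero fun a _ => ?_
    have hfa : n • f a = 0 := by
      have := congrFun hf a
      simpa using this
    have hdvd : n * Nat.card A ∣ n * (f a).val := by
      rw [← ZMod.natCast_zmod_val (f a), nsmul_eq_mul, ← Nat.cast_mul] at hfa
      exact (ZMod.natCast_eq_zero_iff _ _).mp hfa
    obtain ⟨k, hk⟩ := Nat.dvd_of_mul_dvd_mul_left (Nat.pos_of_ne_zero hn) hdvd
    rw [← ZMod.natCast_zmod_val (f a), hφ_nat, hk, mul_nsmul]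
    have : Nat.card A • Additive.ofMul a = 0 := card_nsmul_eq_zero'
    rw [this, nsmul_zero]
  -- (2) the envelope is surjective: `ψ (e_a) = a`
  have hsurjψ : ∀ a : A, ψ (Pi.single a 1) = Additive.ofMul a := by
    intro a
    rw [hψ_apply, Finset.sum_eq_single a]
    · rw [Pi.single_eq_same]
      have := hφ_nat a 1
      rw [Nat.cast_one, one_nsmul] at this
      exact this
    · intro b _ hb
      rw [Pi.single_eq_of_ne hb, map_zero]
    · intro h
      exact absurd (Finset.mem_univ a) h
  -- multiplicative repackaging: `B := Multiplicative ((ℤ/m)^A)`, `α := ψ`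
  let α : Multiplicative (A → ZMod (n * Nat.card A)) →* A := AddMonoidHom.toMultiplicativeLeft ψ
  have hα_apply : ∀ x, α x = Additive.toMul (ψ (Multiplicative.toAdd x)) := fun x => rfl
  have hα_surj : Function.Surjective α := by
    intro a
    refine ⟨Multiplicative.ofAdd (Pi.single a 1), ?_⟩
    rw [hα_apply, toAdd_ofAdd, hsurjψ]
    rfl
  have hα_pow : ∀ x, x ^ n = 1 → α x = 1 := by
    intro x hx
    rw [hα_apply]
    have : n • Multiplicative.toAdd x = 0 := by
      rw [← toAdd_pow, hx, toAdd_one]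
    rw [hkey _ this]
    rfl
  have hBcard : IsSigmaInteger Sigma (Nat.card (Multiplicative (A → ZMod (n * Nat.card A)))) :=
    ⟨Nat.card_pos, fun q hq _ => hSig q hq⟩
  -- the discrete side: lift `χ ∘ ι` generator-wise on the free group `ι⁻¹(U)` (Nielsen–Schreier)
  let ιU : U.comap ι →* U := (ι.comp (U.comap ι).subtype).codRestrict U fun h => h.2
  have hgen : ∀ g : IsFreeGroup.Generators (U.comap ι),
      ∃ b : Multiplicative (A → ZMod (n * Nat.card A)), α b = χ (ιU (IsFreeGroup.of g)) :=
    fun g => hα_surj _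
  choose b hb using hgen
  let f₀ : U.comap ι →* Multiplicative (A → ZMod (n * Nat.card A)) := IsFreeGroup.lift b
  have hf₀ : ∀ h : U.comap ι, α (f₀ h) = χ (ιU h) := by
    intro h
    have := IsFreeGroup.ext_hom (f := α.comp f₀) (g := χ.comp ιU) fun a => by
      simp only [MonoidHom.comp_apply, f₀, IsFreeGroup.lift_of, hb]
    exact DFunLike.congr_fun this h
  -- extend CONTINUOUSLY to `U` ([SemiAnbd] Ex. 2.10, abc-iut-L3)
  obtain ⟨θ, hθc, hθ⟩ := IsProSigmaCompletion.exists_continuous_extend hι U hU hBcard f₀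
  -- `α ∘ θ = χ`: both continuous, equal on the dense `ι(ι⁻¹ U)`
  have hχc : Continuous χ := continuous_of_isOpen_ker χ hχker
  have hαθc : Continuous fun x : U => α (θ x) := continuous_of_discreteTopology.comp hθc
  have hαθ : (fun x : U => α (θ x)) = χ :=
    IsProSigmaCompletion.continuous_ext_on hι U hU hαθc hχc fun γ hγ => by
      show α (θ ⟨ι γ, hγ⟩) = χ ⟨ι γ, hγ⟩
      rw [hθ γ hγ, hf₀]
      rfl
  -- `θ` detects `u ^ n`
  have hθu : θ (u ^ n) ≠ 1 := by
    intro h1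
    rw [map_pow] at h1
    have h2 : α (θ u) = 1 := hα_pow _ h1
    have h3 : χ u = 1 := by rw [← congrFun hαθ u]; exact h2
    exact hχu h3
  refine ⟨Multiplicative (A → ZMod (n * Nat.card A)), inferInstance, inferInstance, θ, ?_,
    fun q _ _ => Set.mem_univ q, hθu⟩
  have : ((θ.ker : Subgroup U) : Set U) = θ ⁻¹' {1} := by
    ext x; simp [MonoidHom.mem_ker]
  rw [this]
  exact (isOpen_discrete _).preimage hθc

/-- The `Σ = 𝔓𝔯𝔦𝔪𝔢𝔰` form (the binder shape of record, GAP-LEDGER G-w4d052-g6-2).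
[cite: Mochizuki2012, Prop 2.4(i) p.50] -/
theorem sigmaCharDetects_univ_pow_of_isProSigmaCompletion_primes {ι : Γ →* P}
    (hι : IsProSigmaCompletion {q | q.Prime} ι) (U : Subgroup P) (hU : IsOpen (U : Set P)) (u : U)
    (n : ℕ) (hn : n ≠ 0) (hdet : SigmaCharDetects Set.univ U u) : SigmaCharDetects Set.univ U (u ^ n) :=
  sigmaCharDetects_univ_pow_of_isProSigmaCompletion hι (fun _ hq => hq) U hU u n hn hdet

end FreeProSigmaStrongTorsionFree

/-! ### B. The genuine 𝔛-datum: the one-call's binder `hTF` from the free-profinite origin of `Δ̂_X` -/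

namespace StableCurveTemperedData

namespace OfSpecialFibre

variable {p : ℕ} [Fact p.Prime] (X : TemperedCurve p)

/-- **The §2 law `hTF` ("`Δ̂_X` is strongly torsion-free", [Config] Rmk 1.2.2, printed form on
`X.DeltaHat`) HOLDS whenever `Δ̂_X` is the profinite completion of a free group** — the origin fact (x) of
the Cor. 2.3 (iii)/(iv) closers of record (`IsProSigmaCompletion {q | q.Prime} ι`, `Γ` free of any rank;
AFFINE hyperbolic `X`).  `Δ̂_X` is profinite as a closed subgroup of `Π_{X_K}`
(`X.isProfiniteCompletion_toHat`). [cite: Mochizuki2012, Prop 2.4(i) p.50] -/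
theorem hTF_of_isProSigmaCompletion {Γ : Type*} [Group Γ] [IsFreeGroup Γ] {ι : Γ →* X.DeltaHat}
    (hι : IsProSigmaCompletion {q | q.Prime} ι) :
    ∀ H : Subgroup X.DeltaHat, IsOpen (H : Set X.DeltaHat) →
      ∀ (h : H) (n : ℕ), n ≠ 0 →
        SigmaCharDetects Set.univ H h → SigmaCharDetects Set.univ H (h ^ n) := by
  have hPi := X.isProfiniteCompletion_toHat
  haveI : CompactSpace X.PiHat := hPi.compactSpace
  haveI : T2Space X.PiHat := hPi.t2Space
  haveI : TotallyDisconnectedSpace X.PiHat := hPi.totallyDisconnectedSpace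
  haveI : CompactSpace X.DeltaHat :=
    isCompact_iff_compactSpace.mp (Subgroup.isClosed_topologicalClosure _).isCompact
  intro H hH h n hn hdet
  exact FreeProSigmaStrongTorsionFree.sigmaCharDetects_univ_pow_of_isProSigmaCompletion_primes hι H hH h
    n hn hdet

/-! ### C. The one-call sequel: `hTF` ↦ the origin binder (x); law count 6 → 5 -/

section OneCall

variable (d : X.GroupLevelData) (T : SpecialFibreTower X.DeltaTemp)
  (Sigma SigmaHat : Set ℕ) (hsub : Sigma ⊆ SigmaHat) (hne : Set.Nonempty Sigma)
  (hprime : ∀ q ∈ SigmaHat, q.Prime)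
  (S : SpecialFibreData (X.toTemperedArithmeticGroup d)) (h36 : S.Gc.Prop36Hypotheses)
  (hp : p ∉ Sigma) (TpH : Subgroup S.chart.G)
  (HatH : Subgroup (TemperedGraphGroupData.exists_completion_of_prop36 S.Gc h36 S.chart).choose)
  (hle : TpH.map (TemperedGraphGroupData.exists_completion_of_prop36 S.Gc h36
    S.chart).choose_spec.choose.toMonoidHom ≤ HatH)
  (cuspMeetsH : {x : X.Pt // X.IsCusp x} → Prop)

/-- **The same, with `ι` landing in the datum's own `Δ̂_X`-field** `(ofSpecialFibre …).DeltaHat` — LITERALLY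
the origin binder (x) displayed by the Cor. 2.3 (iii)/(iv) closers of record — transported along
`ofSpecialFibre_deltaHat : (ofSpecialFibre …).DeltaHat = X.DeltaHat` (`IsProSigmaCompletion.comp_continuousMulEquiv`).
[cite: Mochizuki2012, Prop 2.4(i) p.50] [claim: Mochizuki2012, status: disputed] -/
theorem hTF_of_isProSigmaCompletion_deltaHat {Γ : Type*} [Group Γ] [IsFreeGroup Γ]
    {ι : Γ →* (ofSpecialFibre X d S h36 Sigma SigmaHat hsub hne hprime hp TpH HatH hle cuspMeetsH).DeltaHat}
    (hι : IsProSigmaCompletion {q | q.Prime} ι) :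
    ∀ H : Subgroup X.DeltaHat, IsOpen (H : Set X.DeltaHat) →
      ∀ (h : H) (n : ℕ), n ≠ 0 →
        SigmaCharDetects Set.univ H h → SigmaCharDetects Set.univ H (h ^ n) := by
  have hEq := ofSpecialFibre_deltaHat X d S h36 Sigma SigmaHat hsub hne hprime hp TpH HatH hle cuspMeetsH
  let e : (ofSpecialFibre X d S h36 Sigma SigmaHat hsub hne hprime hp TpH HatH hle cuspMeetsH).DeltaHat ≃ₜ*
      X.DeltaHat :=
    { MulEquiv.subgroupCongr hEq with
      continuous_toFun := Continuous.subtype_mk continuous_subtype_val _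
      continuous_invFun := Continuous.subtype_mk continuous_subtype_val _ }
  exact hTF_of_isProSigmaCompletion X (hι.comp_continuousMulEquiv e)

/-- **[IUTchI] Prop. 2.4 (i)(ii)(iii) ∧ Cor. 2.5 at the genuine 𝔛-datum — the frame one-call with the law
`hTF` REPLACED by the free-profinite ORIGIN of `Δ̂_X`.**  p493190's `prop24_cor25_ofPiData_byName_noRF_frame`
composed with `hTF_of_isProSigmaCompletion`: LAW binders now FIVE — `hNN_i` ((A3) = F-2540 BY NAME on the
per-level PSC data) · `hab` (pro-`Σ` abelianization law along the admissible quotients) · `hadm` (the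
admissible kernels shrink to `1`) · `hI_j^frame` ([SemiAnbd] Thm 5.4 (i) at the canonical Prop 5.2 (iv) frame)
· `hA3ar_j` ((A3-arith), [AbsTopII] Prop 1.3 (iv) / [NodNon] Prop 3.9 (i) coset form) — plus ONE
FACT-INSTANCE-shaped origin binder (x) `hι : IsProSigmaCompletion {q | q.Prime} ι` (`Γ` free; GAP-LEDGER
G-w4d052-g6-2, the binder of the Cor. 2.3 (iii)/(iv) closers of record; there over the datum's `DeltaHat`,
which IS `X.DeltaHat` by `ofSpecialFibre_deltaHat`).  SIDE / DATA binders verbatim from p493190.  CONDITIONAL as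
labelled; nothing of [SemiAnbd] Thm 5.4 or of the origin fact is proved here.
[cite: Mochizuki2012, Prop 2.4 pp.50-51] [cite: Mochizuki2012, Cor 2.5 p.51] [claim: Mochizuki2012, status: disputed] -/
theorem prop24_cor25_ofPiData_byName_noRF_frame_of_freePro (P : SpecialFibreTower.PiData X d S T) (x : {x : X.Pt // X.IsCusp x})
    -- (i): ORIGIN fact (x) of record — `Δ̂_X` is the profinite completion of a free group (GAP G-w4d052-g6-2)
    {Γ : Type*} [Group Γ] [IsFreeGroup Γ] {ι : Γ →* X.DeltaHat} (hι : IsProSigmaCompletion {q | q.Prime} ι)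
    -- (i): per-level PSC data with (A3) := F-2540 BY NAME and the identification side conditions
    (G : ∀ i, PSCDatum (levelGraph X T Sigma SigmaHat hsub hne hprime i).Hat)
    (hNN : ∀ i, (G i).VerticialIntersectionNear)
    (σ : ∀ i, (T.Gc i).graph.Vertex ≃ (G i).graph.V) (Λv : ∀ i, (G i).graph.V → Subgroup (T.chart i).G)
    (hvert : ∀ i (v : (T.Gc i).graph.Vertex), Λv i (σ i v) ∈ verticialSubgroups (T.chart i) v)
    (hΛv : ∀ i v, (Λv i v).map (levelGraph X T Sigma SigmaHat hsub hne hprime i).ι = (G i).vertGp v)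
    (src tgt : ∀ i, (G i).graph.N → (G i).graph.V) (c₁ c₂ : ∀ i, (G i).graph.N → (T.chart i).G)
    (hends : ∀ i e, (G i).graph.nodeEnds e = s(src i e, tgt i e))
    (h₁ : ∀ i e, (G i).nodeGp e ≤
      MulAut.conj ((levelGraph X T Sigma SigmaHat hsub hne hprime i).ι (c₁ i e)) • (G i).vertGp (src i e))
    (h₂ : ∀ i e, (G i).nodeGp e ≤
      MulAut.conj ((levelGraph X T Sigma SigmaHat hsub hne hprime i).ι (c₂ i e)) • (G i).vertGp (tgt i e))
    (hloop : ∀ i e, src i e = tgt i e → (c₁ i e)⁻¹ * c₂ i e ∉ Λv i (src i e))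
    -- (i): the pro-`Σ` abelianization law along the admissible quotients
    (hab : ∀ (i : ℕ) (A : Type) [CommGroup A] [Finite A] (χ : T.N i →* A),
      IsOpen ((χ.ker : Subgroup (T.N i)) : Set (T.N i)) →
      (∀ q : ℕ, q.Prime → q ∣ Nat.card A → q ∈ Sigma) → (T.adm i).toMonoidHom.ker ≤ χ.ker)
    -- (i)(ii): the admissible kernels shrink to `1`
    (hadm : ∀ U ∈ 𝓝 (1 : ↥X.DeltaTemp), ∃ j, ((T.admKer j : Subgroup ↥X.DeltaTemp) : Set ↥X.DeltaTemp) ⊆ U)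
    -- (ii): per-level arithmetic decomposition data, node data, (A3-arith)_j
    {V B : ℕ → Type*}
    (Dd : ∀ j, DecompositionData ((qTowerOfSpecialFibreTower X T d S h36 Sigma SigmaHat hsub hne hprime hp TpH HatH hle cuspMeetsH P.admKer_normal_pi).Q j).Tp (V j) (B j))
    -- (ii): [SemiAnbd] Thm 5.4 (i) at the CANONICAL Prop 5.2 (iv) frame `Π^tp_j ↠ Π^tp_j ⧸ π₁^temp(𝒢_j)`
    (hI : ∀ j, haveI := qTower_map_N_normal X d T Sigma SigmaHat hsub hne hprime S h36 hp TpH HatH hle cuspMeetsH P j;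
      ArithMaximalCompactStatementI (Dd j)
        (QuotientGroup.mk' (((T.N j).map X.DeltaTemp.subtype).map ((qTowerOfSpecialFibreTower X T d S h36 Sigma SigmaHat hsub hne hprime hp TpH HatH hle cuspMeetsH P.admKer_normal_pi).qtp j))))
    {EA : ℕ → Type*} (srcA tgtA : ∀ j, EA j → V j)
    (c₁A c₂A : ∀ j, EA j → ((qTowerOfSpecialFibreTower X T d S h36 Sigma SigmaHat hsub hne hprime hp TpH HatH hle cuspMeetsH P.admKer_normal_pi).Q j).Tp)
    (hA3ar : ∀ (j : ℕ) (Λ : Subgroup X.PiTemp), IsCompact (Λ : Set X.PiTemp) → Λ ≠ ⊥ →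
      IsOpen (Λ.map X.augGK.toMonoidHom : Set X.GK) →
      ∀ (v w : V j) (g h γ : ((qTowerOfSpecialFibreTower X T d S h36 Sigma SigmaHat hsub hne hprime hp TpH HatH hle cuspMeetsH P.admKer_normal_pi).Q j).Hat),
        MulAut.conj γ • Λ.map (((qTowerOfSpecialFibreTower X T d S h36 Sigma SigmaHat hsub hne hprime hp TpH HatH hle cuspMeetsH P.admKer_normal_pi).qhat j).comp X.toHat.toMonoidHom) ≤
            MulAut.conj g • ((Dd j).vertGp v).map ((qTowerOfSpecialFibreTower X T d S h36 Sigma SigmaHat hsub hne hprime hp TpH HatH hle cuspMeetsH P.admKer_normal_pi).Q j).ι →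
        MulAut.conj γ • Λ.map (((qTowerOfSpecialFibreTower X T d S h36 Sigma SigmaHat hsub hne hprime hp TpH HatH hle cuspMeetsH P.admKer_normal_pi).qhat j).comp X.toHat.toMonoidHom) ≤
            MulAut.conj h • ((Dd j).vertGp w).map ((qTowerOfSpecialFibreTower X T d S h36 Sigma SigmaHat hsub hne hprime hp TpH HatH hle cuspMeetsH P.admKer_normal_pi).Q j).ι →
          (v = w ∧ g⁻¹ * h ∈ ((Dd j).vertGp v).map ((qTowerOfSpecialFibreTower X T d S h36 Sigma SigmaHat hsub hne hprime hp TpH HatH hle cuspMeetsH P.admKer_normal_pi).Q j).ι) ∨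
          (∃ (e : EA j) (k : ((qTowerOfSpecialFibreTower X T d S h36 Sigma SigmaHat hsub hne hprime hp TpH HatH hle cuspMeetsH P.admKer_normal_pi).Q j).Hat),
            ∃ p ∈ ((Dd j).vertGp (srcA j e)).map ((qTowerOfSpecialFibreTower X T d S h36 Sigma SigmaHat hsub hne hprime hp TpH HatH hle cuspMeetsH P.admKer_normal_pi).Q j).ι,
            ∃ q ∈ ((Dd j).vertGp (tgtA j e)).map ((qTowerOfSpecialFibreTower X T d S h36 Sigma SigmaHat hsub hne hprime hp TpH HatH hle cuspMeetsH P.admKer_normal_pi).Q j).ι,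
            (srcA j e = v ∧ tgtA j e = w ∧
                g = k * ((qTowerOfSpecialFibreTower X T d S h36 Sigma SigmaHat hsub hne hprime hp TpH HatH hle cuspMeetsH P.admKer_normal_pi).Q j).ι (c₁A j e) * p ∧
                h = k * ((qTowerOfSpecialFibreTower X T d S h36 Sigma SigmaHat hsub hne hprime hp TpH HatH hle cuspMeetsH P.admKer_normal_pi).Q j).ι (c₂A j e) * q) ∨
            (srcA j e = w ∧ tgtA j e = v ∧
                h = k * ((qTowerOfSpecialFibreTower X T d S h36 Sigma SigmaHat hsub hne hprime hp TpH HatH hle cuspMeetsH P.admKer_normal_pi).Q j).ι (c₁A j e) * p ∧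
                g = k * ((qTowerOfSpecialFibreTower X T d S h36 Sigma SigmaHat hsub hne hprime hp TpH HatH hle cuspMeetsH P.admKer_normal_pi).Q j).ι (c₂A j e) * q)) ∨
          (∃ (u : V j) (f : ((qTowerOfSpecialFibreTower X T d S h36 Sigma SigmaHat hsub hne hprime hp TpH HatH hle cuspMeetsH P.admKer_normal_pi).Q j).Hat),
            (∃ (e : EA j) (k : ((qTowerOfSpecialFibreTower X T d S h36 Sigma SigmaHat hsub hne hprime hp TpH HatH hle cuspMeetsH P.admKer_normal_pi).Q j).Hat),
              ∃ p ∈ ((Dd j).vertGp (srcA j e)).map ((qTowerOfSpecialFibreTower X T d S h36 Sigma SigmaHat hsub hne hprime hp TpH HatH hle cuspMeetsH P.admKer_normal_pi).Q j).ι,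
              ∃ q ∈ ((Dd j).vertGp (tgtA j e)).map ((qTowerOfSpecialFibreTower X T d S h36 Sigma SigmaHat hsub hne hprime hp TpH HatH hle cuspMeetsH P.admKer_normal_pi).Q j).ι,
              (srcA j e = v ∧ tgtA j e = u ∧
                  g = k * ((qTowerOfSpecialFibreTower X T d S h36 Sigma SigmaHat hsub hne hprime hp TpH HatH hle cuspMeetsH P.admKer_normal_pi).Q j).ι (c₁A j e) * p ∧
                  f = k * ((qTowerOfSpecialFibreTower X T d S h36 Sigma SigmaHat hsub hne hprime hp TpH HatH hle cuspMeetsH P.admKer_normal_pi).Q j).ι (c₂A j e) * q) ∨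
              (srcA j e = u ∧ tgtA j e = v ∧
                  f = k * ((qTowerOfSpecialFibreTower X T d S h36 Sigma SigmaHat hsub hne hprime hp TpH HatH hle cuspMeetsH P.admKer_normal_pi).Q j).ι (c₁A j e) * p ∧
                  g = k * ((qTowerOfSpecialFibreTower X T d S h36 Sigma SigmaHat hsub hne hprime hp TpH HatH hle cuspMeetsH P.admKer_normal_pi).Q j).ι (c₂A j e) * q)) ∧
            (∃ (e : EA j) (k : ((qTowerOfSpecialFibreTower X T d S h36 Sigma SigmaHat hsub hne hprime hp TpH HatH hle cuspMeetsH P.admKer_normal_pi).Q j).Hat),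
              ∃ p ∈ ((Dd j).vertGp (srcA j e)).map ((qTowerOfSpecialFibreTower X T d S h36 Sigma SigmaHat hsub hne hprime hp TpH HatH hle cuspMeetsH P.admKer_normal_pi).Q j).ι,
              ∃ q ∈ ((Dd j).vertGp (tgtA j e)).map ((qTowerOfSpecialFibreTower X T d S h36 Sigma SigmaHat hsub hne hprime hp TpH HatH hle cuspMeetsH P.admKer_normal_pi).Q j).ι,
              (srcA j e = u ∧ tgtA j e = w ∧
                  f = k * ((qTowerOfSpecialFibreTower X T d S h36 Sigma SigmaHat hsub hne hprime hp TpH HatH hle cuspMeetsH P.admKer_normal_pi).Q j).ι (c₁A j e) * p ∧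
                  h = k * ((qTowerOfSpecialFibreTower X T d S h36 Sigma SigmaHat hsub hne hprime hp TpH HatH hle cuspMeetsH P.admKer_normal_pi).Q j).ι (c₂A j e) * q) ∨
              (srcA j e = w ∧ tgtA j e = u ∧
                  h = k * ((qTowerOfSpecialFibreTower X T d S h36 Sigma SigmaHat hsub hne hprime hp TpH HatH hle cuspMeetsH P.admKer_normal_pi).Q j).ι (c₁A j e) * p ∧
                  f = k * ((qTowerOfSpecialFibreTower X T d S h36 Sigma SigmaHat hsub hne hprime hp TpH HatH hle cuspMeetsH P.admKer_normal_pi).Q j).ι (c₂A j e) * q)))) :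
    ((ofSpecialFibre X d S h36 Sigma SigmaHat hsub hne hprime hp TpH HatH hle cuspMeetsH).Prop24i ∧
      (ofSpecialFibre X d S h36 Sigma SigmaHat hsub hne hprime hp TpH HatH hle cuspMeetsH).Prop24ii ∧
      (ofSpecialFibre X d S h36 Sigma SigmaHat hsub hne hprime hp TpH HatH hle cuspMeetsH).Prop24iii) ∧
    ((ofSpecialFibre X d S h36 Sigma SigmaHat hsub hne hprime hp TpH HatH hle cuspMeetsH).Cor25Decomposition ∧
      (ofSpecialFibre X d S h36 Sigma SigmaHat hsub hne hprime hp TpH HatH hle cuspMeetsH).Cor25Inertia) := by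
  exact prop24_cor25_ofPiData_byName_noRF_frame X d T Sigma SigmaHat hsub hne hprime S h36 hp TpH HatH hle cuspMeetsH
    P x (hTF_of_isProSigmaCompletion X hι) G hNN σ Λv hvert hΛv src tgt c₁ c₂ hends h₁ h₂ hloop hab hadm Dd hI
    srcA tgtA c₁A c₂A hA3ar

end OneCall

end OfSpecialFibre

end StableCurveTemperedData

end Literature.IUT.HodgeTheaters

end
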